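import Literature.Computability.AlgebraicComplexity.SharpPBitsPPolyModP
import Literature.Computability.AlgebraicComplexity.RazElusiveGeneralRouteProofs
import Literature.Computability.AlgebraicComplexity.StandardFamilies
import Mathlib.NumberTheory.Padics.RingHoms
import HarnessLib

/-!
# Cheap permanents over ANY small finite ring `ℤ/m` put `#P` in `FP/poly` — and so do
# cheap permanents with `p`-ADIC INTEGER constants (Bürgisser's Boolean simulation, no primality,
# hence no Chebotarev/GRH step)

Bürgisser, *Cook's versus Valiant's hypothesis*, TCS 235 (2000), §5 (A3), p. 86, simulates an
arithmetic circuit over a finite prime field `𝔽_p` (the prime and the constants being advice) by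
Boolean circuits of size `(log p)^{O(1)} · size`; the tree proves that form in
`SharpPBitsPPolyModP.lean` (`PSharpP_subset_PPoly_of_modP_perPoly`). The primality of the modulus
plays NO role in the simulation (it is needed upstream, in Bürgisser's §4, only to reduce ALGEBRAIC
constants modulo a prime — the step that costs GRH). This file records the modulus form and its
consequence for `p`-adic integer constants:

* `cktSize_testBit_countWitnesses_modM`, `sharpP_bitCircuits_of_modM_perPoly`,
  `PSharpP_subset_PPoly_of_modM_perPoly`, `NP_subset_PPoly_of_modM_perPoly`,
  `NP_subset_PPoly_of_isPBounded_modM_perPoly`: if for every `N` some modulus `m` with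
  `2^N < m ≤ 2^{r(N)}` has `L_{ℤ/m}(PER_N) ≤ s(N)` (`r`, `s` p-bounded; fan-in-two circuits over
  `ZMod m` with arbitrary ring constants), then every `#P` function has polynomial-size Boolean
  circuits for its bits, `P^{#P} ⊆ P/poly` and `NP ⊆ P/poly`. The proof is the tree's mod-`p` proof
  VERBATIM with `Fact p.Prime` replaced by `NeZero m` (all the Boolean simulation
  `cktSize_testBits_aeval_eval` asks for) — Valiant's criterion and Bürgisser's Thm. 2.10
  (`exists_countPoly`, `ArithCircuit.exists_permanent_boolSum`) give `2^K f(x) = per B(x)`; pad `B`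
  by an identity block to size `N' = CF + m + 1` so that the modulus exceeds `2^K f(x)`; lift the
  `ℤ/m`-circuit for `PER_{N'}` to `ℤ` (`ArithCircuit.mapConsts`), substitute the entries, simulate
  modulo `m`, read bits `K, …, K + m`.
* `PSharpP_subset_PPoly_of_zmodPrimePow_perPoly`: the prime-power moduli `p^{N+1}` suffice.
* `PSharpP_subset_PPoly_of_isPComputable_perPoly_padicInt`,
  `NP_subset_PPoly_of_isPComputable_perPoly_padicInt`: **if the permanent is p-computable over the
  `p`-adic integers `ℤ_p` (polynomial-size circuits with constants in `ℤ_p`), then `P^{#P} ⊆ P/poly`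
  and `NP ⊆ P/poly` — unconditionally.** A `ℤ_p`-circuit reduces modulo `p^{N+1}` along the ring
  map `PadicInt.toZModPow` (extension of scalars is free, `ArithCircuit.complexity_map_le`), and
  `2^N < p^{N+1} ≤ 2^{p(N+1)}`. Contrast: for COMPLEX (equivalently `ℚ̄`-) constants the same
  conclusion is Bürgisser's Cor. 1.2 and needs GRH to FIND a small prime modulo which the algebraic
  constants reduce (tree: `BurgisserReductionModPrimes.lean`); over `ℤ_p` no prime has to be found.

Honest framing: Boolean bookkeeping of conditional transfers; `VP ≠ VNP`, `P^{#P} ⊄ P/poly` and the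
`2`-adic hardness of the permanent are NOT proved and nothing here is progress on them. No new
definitions, no named facts, no sorry.

## References
* P. Bürgisser, *Cook's versus Valiant's hypothesis*, Theoret. Comput. Sci. 235 (2000) 71–88,
  §5 (A3), p. 86; Cor. 1.2, p. 74 [Burgisser2000TCS].
* P. Bürgisser, ECCC TR06-113 (2006), Lemma 2.12, p. 8 [Burgisser2006].
* P. Bürgisser, *Completeness and Reduction in Algebraic Complexity Theory* (2000), §4.1
  (extension of scalars) [Burgisser2000].
-/

noncomputable section

namespace Literature.Computability.AlgebraicComplexity

open MvPolynomial Complexity ArithCircuit CircuitArith _root_.Computability Matrix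

/-! ### The fixed-length core, modulus form -/

/-- **Bits of `#{y | ⟨x, y⟩ ∈ R}` by Boolean circuits, from cheap permanents over small finite
rings `ℤ/m`** (Bürgisser 2000 TCS §5 (A3) / TR06-113 Lemma 2.12, the advice prime replaced by an
arbitrary advice MODULUS): if for every `N` some `m` with `2^N < m ≤ 2^{N^a + a}` has
`L_{ℤ/m}(PER_N) ≤ N^b + b`, then from a `B₂`-program of size `S` for `(x, y) ↦ [⟨x, y⟩ ∈ R]` on
`{0,1}ⁿ × {0,1}^m` and any `CF ≥ cfBound (60 S + 1) (3 S + 2) (m + S)`, the `m + 1` bits of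
`x ↦ #{y ∈ {0,1}^m | ⟨x, y⟩ ∈ R}` have `B₂`-circuits of size
`((CF+m+1)^b + b + 1) · (2 + 65 ((CF+m+1)^a + a + 2)³)`. The tree's mod-`p` proof
(`cktSize_testBit_countWitnesses_modP`) verbatim, primality never used. [cite: Burgisser2000TCS, §5 (A3) p. 86] -/
theorem cktSize_testBit_countWitnesses_modM {a b : ℕ}
    (hper : ∀ N : ℕ, ∃ p : ℕ, 2 ^ N < p ∧ p ≤ 2 ^ (N ^ a + a) ∧
      complexity (perPoly (Fin N) (ZMod p)) ≤ N ^ b + b)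
    (R : Language Bool) (n m S CF : ℕ)
    (hCF : cfBound (60 * S + 1) (3 * S + 2) (m + S) ≤ CF)
    (hR : CktSize B2 (fun (w : Fin n ⊕ Fin m → Bool) (_ : Unit) =>
      R.boolIndicator (boolPair (List.ofFn fun i => w (.inl i)) (List.ofFn fun j => w (.inr j)))) S) :
    CktSize B2 (fun (x : Fin n → Bool) (i : Fin (m + 1)) => (countWitnesses R m (List.ofFn x)).testBit i)
      (((CF + m + 1) ^ b + b + 1) * (2 + 65 * ((CF + m + 1) ^ a + a + 2) ^ 3)) := by
  classical
  -- adapted from `cktSize_testBit_countWitnesses_modP` (SharpPBitsPPolyModP.lean), prime ↦ modulus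
  -- [1] the circuit for `R` on pairs
  obtain ⟨Q, hQB, hQs, hQe⟩ := hR.toCircuit
  -- [2] the counting polynomial and its constant-free circuit
  obtain ⟨G, ⟨P, hP2, hPc, hPe, hPs, hPd⟩, hG⟩ := exists_countPoly Q hQB
  -- [3] the permanent form of its Boolean sum
  obtain ⟨N, K, B, hNK, hB, hperB⟩ := ArithCircuit.exists_permanent_boolSum P hP2 hPc
  have hPg : P.gates.length ≤ 60 * S + 1 := by unfold ArithCircuit.size at hPs; omega
  have hNKle : N + K ≤ CF := hNK.trans ((cfBound_mono hPg (hPd.trans (by omega)) (by omega)).trans hCF)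
  -- the value of the Boolean sum at `x`
  set cnt : (Fin n → Bool) → ℕ := fun x =>
    (Finset.univ.filter fun y : Fin m → Bool => Q.eval (Sum.elim x y) = true).card with hcnt
  have hcnt_eq : ∀ x, countWitnesses R m (List.ofFn x) = cnt x := fun x =>
    countWitnesses_eq_card_filter R m (List.ofFn x) _ fun y => by
      rw [hQe, ← Set.mem_iff_boolIndicator]
      simp only [Sum.elim_inl, Sum.elim_inr]
      exact Iff.rfl
  have hcnt_le : ∀ x, cnt x ≤ 2 ^ m := fun x =>
    (Finset.card_filter_le _ _).trans (by simp [Finset.card_univ])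
  have heval : ∀ x : Fin n → Bool, eval (toK ℤ ∘ x) B.permanent = ((2 ^ K * cnt x : ℕ) : ℤ) := by
    intro x
    have hPe' : P.eval = G := hPe
    rw [hperB, map_mul, hPe', hG x]
    simp [hcnt]
  -- [3'] pad `B` by an identity block to size `N' = CF + m + 1`
  obtain ⟨T, hT⟩ : ∃ T, N + T = CF + m + 1 := ⟨CF + m + 1 - N, by omega⟩
  set B' : Matrix (Fin (N + T)) (Fin (N + T)) (MvPolynomial (Fin n) ℤ) :=
    (Matrix.fromBlocks B 0 0 (1 : Matrix (Fin T) (Fin T) (MvPolynomial (Fin n) ℤ))).submatrix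
      finSumFinEquiv.symm finSumFinEquiv.symm with hB'
  have hperm' : B'.permanent = B.permanent := by
    rw [hB', permanent_submatrix_equiv, permanent_fromBlocks_zero₁₂, permanent_one, mul_one]
  have hB'0 : ∀ i j, complexity (B' i j) = 0 := by
    intro i j
    simp only [hB', Matrix.submatrix_apply]
    rcases finSumFinEquiv.symm i with i' | i' <;> rcases finSumFinEquiv.symm j with j' | j'
    · simpa using (hB i' j').complexity_eq_zero
    · simp only [Matrix.fromBlocks_apply₁₂, Matrix.zero_apply]
      rw [← C_0]; exact complexity_C_holds _
    · simp only [Matrix.fromBlocks_apply₂₁, Matrix.zero_apply]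
      rw [← C_0]; exact complexity_C_holds _
    · simp only [Matrix.fromBlocks_apply₂₂]
      by_cases h : i' = j'
      · subst h
        rw [Matrix.one_apply_eq, ← C_1]
        exact complexity_C_holds _
      · rw [Matrix.one_apply_ne h, ← C_0]; exact complexity_C_holds _
  -- [4] the advice modulus for `N'` and the `ℤ/p`-circuit for `PER_{N'}`, lifted to `ℤ`
  obtain ⟨p, hpN, hpa, hpc⟩ := hper (N + T)
  have hp1' : 1 < p := lt_of_le_of_lt Nat.one_le_two_pow hpN
  haveI : NeZero p := ⟨by omega⟩
  haveI hp1 : Fact (1 < p) := ⟨hp1'⟩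
  obtain ⟨P', hP'2, hP'c, hP's⟩ := exists_computes_size_eq_complexity (perPoly (Fin (N + T)) (ZMod p))
  set ψ : ℤ →+* ZMod p := Int.castRingHom (ZMod p) with hψ
  set ρ : ZMod p → ℤ := fun c => ((c.val : ℕ) : ℤ) with hρ
  have hρψ : ∀ c : ZMod p, ψ (ρ c) = c := fun c => by simp [hψ, hρ]
  set Qz : MvPolynomial (Fin (N + T) × Fin (N + T)) ℤ := (P'.mapConsts ρ).eval with hQz
  have hQzp : MvPolynomial.map ψ Qz = perPoly (Fin (N + T)) (ZMod p) := by
    have h1 : (P'.mapConsts ρ).map ψ = P' := map_mapConsts_eq_self ρ ψ P' (fun c _ => hρψ c)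
    have h2 := eval_map_apply ψ (P'.mapConsts ρ)
    rw [h1] at h2
    rw [hQz, ← h2]
    exact hP'c
  have hQzc : complexity Qz ≤ (N + T) ^ b + b := by
    refine (complexity_le_size (hP'2.mapConsts ρ) rfl).trans ?_
    rw [size_mapConsts, hP's]
    exact hpc
  -- [4'] substitute the entries of `B'`
  set Rz : MvPolynomial (Fin n) ℤ := aeval (fun ij : Fin (N + T) × Fin (N + T) => B' ij.1 ij.2) Qz
    with hRz
  have hRzc : complexity Rz ≤ (N + T) ^ b + b := by
    refine (complexity_aeval_le _ _).trans ?_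
    rw [Finset.sum_eq_zero (fun ij _ => hB'0 ij.1 ij.2), add_zero]
    exact hQzc
  have hRzp : MvPolynomial.map ψ Rz = MvPolynomial.map ψ B.permanent := by
    rw [hRz, MvPolynomial.aeval_eq_bind₁, map_bind₁, hQzp, ← hperm',
      ← Matrix.permanent_map_ringHom (MvPolynomial.map ψ) B']
    exact bind₁_entries_perPoly (B'.map (MvPolynomial.map ψ))
  -- evaluation commutes with the reduction `ψ : ℤ → ℤ/p`
  have ringHom_eval : ∀ (z : Fin n → ℤ) (F : MvPolynomial (Fin n) ℤ),
      ψ (eval z F) = eval (ψ ∘ z) (MvPolynomial.map ψ F) := fun z F => by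
    rw [MvPolynomial.eval_map, show eval z F = eval₂ (RingHom.id ℤ) z F from rfl,
      MvPolynomial.eval₂_comp_left, RingHom.comp_id]
  -- the input bits as residues modulo `p`: bit `0` is the input wire, the other bits are `0`
  have hinput : ∀ v : Fin n, CktSize B2
      (fun (y : Fin n → Bool) => testBits ((N + T) ^ a + a) (if y v then (1 : ZMod p) else 0).val) 1 := by
    intro v
    have h := ((CktSize.proj B2 fun _ : Unit => v).pair (cktSize_const (Fin n) false)).outMap
      (fun i : Fin ((N + T) ^ a + a) => if i.val = 0 then Sum.inl () else Sum.inr ())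
    refine (h.congr fun y i => ?_).of_le (by norm_num)
    by_cases hi : i.val = 0
    · simp only [hi, if_true, Sum.elim_inl, testBits_apply]
      cases y v
      · simp
      · simp [ZMod.val_one]
    · simp only [hi, if_false, Sum.elim_inr, testBits_apply]
      cases y v
      · simp
      · rw [if_pos rfl, ZMod.val_one, ← Nat.pow_zero 2, Nat.testBit_two_pow_of_ne (Ne.symm hi)]
  -- an optimal integer circuit for `Rz`, simulated modulo `p`
  obtain ⟨Rc, hRc2, hRcc, hRcs⟩ := exists_computes_size_eq_complexity Rz
  have hNT : N + T < (N + T) ^ a + a :=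
    (Nat.pow_lt_pow_iff_right (by norm_num : 1 < 2)).1 (lt_of_lt_of_le hpN hpa)
  have hsim := cktSize_testBits_aeval_eval (p := p) (ℓ := (N + T) ^ a + a) hpa
    (fun (x : Fin n → Bool) (v : Fin n) => if x v then (1 : ZMod p) else 0)
    hinput Rc hRc2
  -- the simulated value is `2^K · cnt x`
  have hval : ∀ x : Fin n → Bool,
      (aeval (fun v => if x v then (1 : ZMod p) else 0) Rc.eval).val = 2 ^ K * cnt x := by
    intro x
    have hz : (fun v => if x v then (1 : ZMod p) else 0) =
        fun v => (((toK ℤ ∘ x) v : ℤ) : ZMod p) := by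
      funext v
      by_cases h : x v <;> simp [toK, h]
    have hRce' : Rc.eval = Rz := hRcc
    have hlt : 2 ^ K * cnt x < p := by
      calc 2 ^ K * cnt x ≤ 2 ^ K * 2 ^ m := Nat.mul_le_mul_left _ (hcnt_le x)
        _ = 2 ^ (K + m) := (pow_add _ _ _).symm
        _ < 2 ^ (N + T) := Nat.pow_lt_pow_right (by norm_num) (by omega)
        _ < p := hpN
    rw [hz, hRce', aeval_intCast_point, show ((eval (toK ℤ ∘ x) Rz : ℤ) : ZMod p) =
        ψ (eval (toK ℤ ∘ x) Rz) from rfl, ringHom_eval, hRzp, ← ringHom_eval, heval x,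
      hψ, map_natCast, ZMod.val_natCast_of_lt hlt]
  -- [5] output bits `K, …, K + m`
  refine ((hsim.outMap fun i : Fin (m + 1) => (⟨K + i, by omega⟩ : Fin ((N + T) ^ a + a))).congr
    fun x i => ?_).of_le ?_
  · simp only [testBits_apply]
    rw [hval x, Nat.testBit_two_pow_mul, hcnt_eq x]
    simp
  · -- size
    rw [hT] at hRzc
    rw [hT]
    refine Nat.mul_le_mul (Nat.succ_le_succ (hRcs ▸ hRzc)) (((gateCost_le _ 1)).trans ?_)
    omega

/-! ### `#P ⊆ FP/poly`, `P^{#P} ⊆ P/poly`, `NP ⊆ P/poly` under cheap `PER` modulo small `m` -/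

/-- **Cheap `PER` over small finite rings `ℤ/m` ⟹ `#P ⊆ FP/poly`** (Bürgisser 2000 TCS §5 (A3);
TR06-113 Lemma 2.12, advice modulus in place of the advice prime): every `#P` function has
polynomial-size circuits for its bits. [cite: Burgisser2000TCS, §5 (A3) p. 86] -/
theorem sharpP_bitCircuits_of_modM_perPoly {a b : ℕ}
    (hper : ∀ N : ℕ, ∃ p : ℕ, 2 ^ N < p ∧ p ≤ 2 ^ (N ^ a + a) ∧
      complexity (perPoly (Fin N) (ZMod p)) ≤ N ^ b + b)
    {f : List Bool → ℕ} (hf : f ∈ SharpP) : Nonempty (BitCircuits f) := by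
  -- adapted from `sharpP_bitCircuits_of_modP_perPoly` (SharpPBitsPPolyModP.lean)
  obtain ⟨R, hRP, p, hfR⟩ := hf
  obtain ⟨q, hq⟩ := exists_cktSize_boolPair_of_mem_PPoly (P_subset_PPoly_holds hRP)
  -- the certificate length and the pair-circuit size as p-bounded functions of the input length
  set pf : ℕ → ℕ := fun n => p.eval n with hpf
  set S : ℕ → ℕ := fun n => (2 * n + 2 + pf n) + q.eval (2 * n + 2 + pf n) with hS
  have hp : IsPBounded pf := (isPBounded_iff_exists_polynomial_holds pf).2 ⟨p, fun n => le_rfl⟩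
  have hlin : IsPBounded fun n => 2 * n + 2 + pf n :=
    IsPBounded.add_holds (IsPBounded.add_holds (IsPBounded.mul_holds (IsPBounded.const 2) IsPBounded.id)
      (IsPBounded.const 2)) hp
  have hq' : IsPBounded fun k => q.eval k := (isPBounded_iff_exists_polynomial_holds _).2 ⟨q, fun n => le_rfl⟩
  have hSb : IsPBounded S := IsPBounded.add_holds hlin (IsPBounded.comp_holds hq' hlin)
  -- the size of the bit circuits is p-bounded along `pf` and `S`
  have hsize : IsPBounded fun n =>
      ((cfBound (60 * S n + 1) (3 * S n + 2) (pf n + S n) + pf n + 1) ^ b + b + 1) *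
        (2 + 65 * ((cfBound (60 * S n + 1) (3 * S n + 2) (pf n + S n) + pf n + 1) ^ a + a + 2) ^ 3) := by
    have h : IsPBounded fun n => cfBound (60 * S n + 1) (3 * S n + 2) (pf n + S n) :=
      isPBounded_cfBound
        (IsPBounded.add_holds (IsPBounded.mul_holds (IsPBounded.const 60) hSb) (IsPBounded.const 1))
        (IsPBounded.add_holds (IsPBounded.mul_holds (IsPBounded.const 3) hSb) (IsPBounded.const 2))
        (IsPBounded.add_holds hp hSb)
    have h' : IsPBounded fun n => cfBound (60 * S n + 1) (3 * S n + 2) (pf n + S n) + pf n + 1 :=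
      IsPBounded.add_holds (IsPBounded.add_holds h hp) (IsPBounded.const 1)
    exact IsPBounded.mul_holds
      (IsPBounded.add_holds (IsPBounded.add_holds (IsPBounded.pow_holds h' b) (IsPBounded.const b))
        (IsPBounded.const 1))
      (IsPBounded.add_holds (IsPBounded.const 2)
        (IsPBounded.mul_holds (IsPBounded.const 65)
          (IsPBounded.pow_holds (IsPBounded.add_holds (IsPBounded.add_holds (IsPBounded.pow_holds h' a)
            (IsPBounded.const a)) (IsPBounded.const 2)) 3)))
  obtain ⟨s, hs⟩ := (isPBounded_iff_exists_polynomial_holds _).1 hsize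
  refine ⟨{ K := p + 1, s := s, lt := fun x => ?_, ckt := fun n => ?_ }⟩
  · -- `f x ≤ 2^{p |x|} < 2^{p |x| + 1}`
    rw [hfR x, Polynomial.eval_add, Polynomial.eval_one, pow_succ]
    have : countWitnesses R (p.eval x.length) x ≤ 2 ^ p.eval x.length := by
      classical
      unfold countWitnesses
      exact (Finset.card_filter_le _ _).trans (by simp [Finset.card_univ, card_vector])
    have h1 : 1 ≤ 2 ^ p.eval x.length := Nat.one_le_two_pow
    omega
  · have key := (cktSize_testBit_countWitnesses_modM hper R n (pf n) (S n) _ le_rfl (hq n (pf n))).of_le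
      (hs n)
    have e : (p + 1).eval n = pf n + 1 := by simp [hpf]
    refine (key.outMap fun i : Fin ((p + 1).eval n) => Fin.cast e i).congr fun x i => ?_
    simp only [Fin.val_cast]
    rw [hfR, List.length_ofFn]

/-- Hence **`P^{#P} ⊆ P/poly`** under cheap `PER` modulo small `m` (the bit graph of every `#P`
function is in `P/poly`, which is closed under polynomial-time Turing reductions). [cite: Burgisser2000TCS, §5 (A3) p. 86] -/
theorem PSharpP_subset_PPoly_of_modM_perPoly {a b : ℕ}
    (hper : ∀ N : ℕ, ∃ p : ℕ, 2 ^ N < p ∧ p ≤ 2 ^ (N ^ a + a) ∧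
      complexity (perPoly (Fin N) (ZMod p)) ≤ N ^ b + b) : PSharpP ⊆ PPoly := by
  intro L hL
  obtain ⟨f, hf, hLf⟩ := Set.mem_iUnion₂.1 hL
  obtain ⟨Bc⟩ := sharpP_bitCircuits_of_modM_perPoly hper hf
  exact Bc.PRel_ofFun_subset_PPoly_of_bitCircuits hLf

/-- Hence **`NP ⊆ P/poly`** under cheap `PER` modulo small `m` (`NP ⊆ P^{#P}`). [cite: Burgisser2000TCS, §5 (A3) p. 86] -/
theorem NP_subset_PPoly_of_modM_perPoly {a b : ℕ}
    (hper : ∀ N : ℕ, ∃ p : ℕ, 2 ^ N < p ∧ p ≤ 2 ^ (N ^ a + a) ∧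
      complexity (perPoly (Fin N) (ZMod p)) ≤ N ^ b + b) : Nondeterministic.NP ⊆ PPoly :=
  fun _L hL => PSharpP_subset_PPoly_of_modM_perPoly hper (NP_subset_PSharpP_holds hL)

/-- **The p-bounded form**: if there are p-bounded `r`, `s` and, for every `N`, a modulus `m` with
`2^N < m ≤ 2^{r(N)}` and `L_{ℤ/m}(PER_N) ≤ s(N)` (ring constants as advice), then
`P^{#P} ⊆ P/poly`. [cite: Burgisser2000TCS, §5 (A3) p. 86] -/
theorem PSharpP_subset_PPoly_of_isPBounded_modM_perPoly {r s : ℕ → ℕ} (hr : IsPBounded r)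
    (hs : IsPBounded s)
    (hper : ∀ N : ℕ, ∃ p : ℕ, 2 ^ N < p ∧ p ≤ 2 ^ r N ∧
      complexity (perPoly (Fin N) (ZMod p)) ≤ s N) : PSharpP ⊆ PPoly := by
  obtain ⟨a, ha⟩ := hr
  obtain ⟨b, hb⟩ := hs
  refine PSharpP_subset_PPoly_of_modM_perPoly (a := a) (b := b) fun N => ?_
  obtain ⟨p, h1, h2, h3⟩ := hper N
  exact ⟨p, h1, h2.trans (Nat.pow_le_pow_right (by norm_num) (ha N)), h3.trans (hb N)⟩

/-- **The p-bounded form for `NP`**: under the same hypothesis, `NP ⊆ P/poly`. [cite: Burgisser2000TCS, §5 (A3) p. 86] -/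
theorem NP_subset_PPoly_of_isPBounded_modM_perPoly {r s : ℕ → ℕ} (hr : IsPBounded r)
    (hs : IsPBounded s)
    (hper : ∀ N : ℕ, ∃ p : ℕ, 2 ^ N < p ∧ p ≤ 2 ^ r N ∧
      complexity (perPoly (Fin N) (ZMod p)) ≤ s N) : Nondeterministic.NP ⊆ PPoly :=
  fun _L hL => PSharpP_subset_PPoly_of_isPBounded_modM_perPoly hr hs hper (NP_subset_PSharpP_holds hL)

/-! ### Prime-power moduli and `p`-adic integer constants -/

/-- **Prime-power moduli suffice**: if `L_{ℤ/p^{N+1}}(PER_N) ≤ s(N)` for a p-bounded `s` and a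
fixed `p ≥ 2` (not necessarily prime), then `P^{#P} ⊆ P/poly` — `2^N < p^{N+1} ≤ 2^{p (N+1)}`.
[cite: Burgisser2000TCS, §5 (A3) p. 86] -/
theorem PSharpP_subset_PPoly_of_zmodPow_perPoly {p : ℕ} (hp : 2 ≤ p) {s : ℕ → ℕ}
    (hs : IsPBounded s)
    (hper : ∀ N : ℕ, complexity (perPoly (Fin N) (ZMod (p ^ (N + 1)))) ≤ s N) :
    PSharpP ⊆ PPoly := by
  have hr : IsPBounded fun N => p * (N + 1) :=
    IsPBounded.mul_holds (IsPBounded.const p) (IsPBounded.add_holds IsPBounded.id (IsPBounded.const 1))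
  refine PSharpP_subset_PPoly_of_isPBounded_modM_perPoly hr hs fun N => ⟨p ^ (N + 1), ?_, ?_, hper N⟩
  · calc 2 ^ N < 2 ^ (N + 1) := Nat.pow_lt_pow_right (by norm_num) (Nat.lt_succ_self N)
      _ ≤ p ^ (N + 1) := Nat.pow_le_pow_left hp _
  · calc p ^ (N + 1) ≤ (2 ^ p) ^ (N + 1) := Nat.pow_le_pow_left (Nat.lt_two_pow_self).le _
      _ = 2 ^ (p * (N + 1)) := by rw [← pow_mul]

/-- **Cheap permanents with `p`-ADIC INTEGER constants put `P^{#P}` in `P/poly`, unconditionally.**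
If `per` is p-computable over `ℤ_p` (`IsPComputable`: `L_{ℤ_p}(PER_N) ≤ N^c + c`), then
`P^{#P} ⊆ P/poly`: reduce the `ℤ_p`-circuit modulo `p^{N+1}` along `PadicInt.toZModPow (N+1)`
(`ArithCircuit.complexity_map_le`, `map_perPoly`) and apply the modulus form of Bürgisser's
simulation. For complex / `ℚ̄` constants the analogous statement (Bürgisser 2000 TCS Cor. 1.2) is
known only under GRH, which is used to find a small prime modulo which the constants reduce; over
`ℤ_p` there is nothing to find. Honest framing: a conditional transfer; neither side is proved.
[cite: Burgisser2000TCS, §5 (A3) p. 86; Cor. 1.2 p. 74] -/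
theorem PSharpP_subset_PPoly_of_isPComputable_perPoly_padicInt (p : ℕ) [Fact p.Prime]
    (h : IsPComputable (fun N => perPoly (Fin N) ℤ_[p])) : PSharpP ⊆ PPoly := by
  obtain ⟨c, hc⟩ := h
  refine PSharpP_subset_PPoly_of_zmodPow_perPoly (p := p) (Nat.Prime.two_le Fact.out)
    (s := fun N => N ^ c + c) ⟨c, fun N => le_rfl⟩ fun N => ?_
  have hle := ArithCircuit.complexity_map_le (PadicInt.toZModPow (p := p) (N + 1))
    (perPoly (Fin N) ℤ_[p])
  rw [map_perPoly] at hle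
  exact hle.trans (hc N)

/-- Hence **`NP ⊆ P/poly`** if the permanent is p-computable over `ℤ_p` (any prime `p`),
unconditionally. [cite: Burgisser2000TCS, §5 (A3) p. 86; Cor. 1.2 p. 74] -/
theorem NP_subset_PPoly_of_isPComputable_perPoly_padicInt (p : ℕ) [Fact p.Prime]
    (h : IsPComputable (fun N => perPoly (Fin N) ℤ_[p])) : Nondeterministic.NP ⊆ PPoly :=
  fun _L hL => PSharpP_subset_PPoly_of_isPComputable_perPoly_padicInt p h (NP_subset_PSharpP_holds hL)

/-- Contrapositive, the form lower-bound transfers use: **`P^{#P} ⊄ P/poly` ⟹ the permanent is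
not p-computable over `ℤ_p`** (for every prime `p`), unconditionally. [cite: Burgisser2000TCS, §5 (A3) p. 86; Cor. 1.2 p. 74] -/
theorem not_isPComputable_perPoly_padicInt_of_not_PSharpP_subset_PPoly (p : ℕ) [Fact p.Prime]
    (h : ¬ (PSharpP ⊆ PPoly)) : ¬ IsPComputable (fun N => perPoly (Fin N) ℤ_[p]) :=
  fun hP => h (PSharpP_subset_PPoly_of_isPComputable_perPoly_padicInt p hP)

end Literature.Computability.AlgebraicComplexity
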